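import Summits.Ventures.CertifiedManyBodySolver.Downfold.EmeryBoxesYBCO7ThermalCapRetiltBoxp1
import Literature.MathematicalPhysics.QuantumLattice.EmeryThreeBandThermalMarkovCap
import HarnessLib

/-!
# ENTROPY-RESOLVED `T > 0` CAP WORD on `emeryBoxYBCO7planeY6K26` (level εp = -46/5): the four kgp1x5 corner sector tables, re-tilted SECTOR-WISE to the common level and read through
# the Markov / conditional-entropy law of the `CuO₄` plus — `40.3430·β + 6 log 2 → maxᵢ log Fᵢ(β)` (`40.3430·β + 2.7081` for large β); hubbard-box-p1 g22, by value

Venture CertifiedManyBodySolver, cell `pub/hubbard-downfold` (S1 = ROUTER) × crew hubbard-fast S2 (ii) × (iv) «T > 0 × multi-band» (D-0096 (ii)); seat hubbard-box-p1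
(row «joint laws; box ⊂ ∪ cells ⇒ word»), by value for the word owner hubbard-downfold-mod-4. Namespace `Summit.Ventures.CertifiedManyBodySolver.Downfold`.
Same construction as `EmeryThermalMarkovCapLa214Boxp1` (La₂CuO₄ #18, p668548).

INPUTS BY NAME: `EmeryBoxesYBCO7ThermalCapRetiltBoxp1` (dictionary-form tables `ybco7planeY6K26Floor_table i` of box-p2's `kgp1x5_<c>_sigma/_table`, YBCO7x_c0_ll_mum92o10, YBCO7x_c1_hl_mum98o10, YBCO7x_c2_lh_mum95o10, YBCO7x_c3_hh_mum101o10; tilts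
`μ = (-46/5, -49/5, -19/2, -101/10)`; its FLAT re-tilted word `emeryBoxYBCO7planeY6K26_pressureCap_m46o5_retilt`: `P_cell ≤ 6 log 2 + β·806861/20000`); the Literature laws
`EmeryThreeBandThermalMarkovCap.emeryCellPressure_le_log_of_gpSectorFloors` (Markov cap of the plus from sector floors: `P_cell ≤ log max_{n≤4} Σ_{j≤6} C(6,j)·e^{−(β/M)q(j+n)}`)
and `EmeryThreeBandCuO4CertificateRetilt.sectorFloors_plusGP_retilt` (`qᵢ(k) = σᵢ(k) + max(cᵢ·k + min(0,2cᵢ), 2cᵢ·k − 4·max(0,2cᵢ))`, `cᵢ = εp − μᵢ = (0, 3/5, 3/10, 9/10)`);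
the box door `holdsOn_emeryCellPressureCap_of_cornerCaps` (`EmeryThermalSeam`, convexity of the pressure in the couplings) with `emeryLine_lowerCorner_level` / `ybco7planeY6K26_lowerCorner`.

BY VALUE [float, `gen-g22/gen_markov_box.py`; exact rationals inside the theorems]: box word at εp = -46/5, flat re-tilted `40.3430·β + 6 log 2` vs Markov `maxᵢ log Fᵢ(β)`:
| β (1/eV) | flat | Markov | gain (nats/CuO₂) |
|---|---|---|---|
| 0.05 | 6.176 | 6.021 | 0.155 |
| 0.1 | 8.193 | 7.902 | 0.291 |
| 0.5 | 24.330 | 23.402 | 0.929 |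
| 1 | 44.502 | 43.283 | 1.219 |
| 5 | 205.874 | 204.428 | 1.446 |
| 10 | 407.589 | 406.139 | 1.451 |
| 40 | 1617.881 | 1616.430 | 1.451 |
(asymptotic gain `1.4508`; corner 3 binds in sector k = 8). HONEST FRAMING: CERTIFIED inequalities on a SCREENING-GRADE object (box ends [float]/DFT, locators in
the router's BOXES files); the improvement is in the CONSTANT only (of the `6 log 2 = 4.159`), the β-slope `40.3430` is the `T = 0` floor's and the cap−floor
slope mismatch is unchanged — thermal scales are NOT resolved; grand-canonical statements at a stated level; no phase word; no router number moves.
WHAT-THIS-IS-NOT: a certificate or a number of record — a reading of existing kernel tables through a new law (zero kit).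
-/

noncomputable section

namespace Summit.Ventures.CertifiedManyBodySolver.Downfold

open NonemptyInterval Matrix Finset Literature.Probability.LatticeModels
open Literature.MathematicalPhysics.QuantumLattice Literature.Computation.Certificates
open Summit.Ventures.CertifiedManyBodySolver.Certificates OccupationCode ClusterLowerBound
open scoped BigOperators ComplexOrder

/-- Each Markov sum is positive (its `j = 0` term is an exponential). [folklore] -/
private theorem sum_choose_exp_pos' (g : ℕ → ℝ) : 0 < ∑ j ∈ Finset.range 7, ((Nat.choose 6 j : ℕ) : ℝ) * Real.exp (g j) :=
  lt_of_lt_of_le (mul_pos (by norm_num) (Real.exp_pos (g 0)))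
    (Finset.single_le_sum (f := fun j => ((Nat.choose 6 j : ℕ) : ℝ) * Real.exp (g j)) (fun j _ => by positivity)
      (Finset.mem_range.2 (by norm_num)))

/-! ## §1 The four sector tables re-tilted to the common level εp = -46/5, sector by sector -/

/-- **Corner 0, level -46/5** (from tilt `-46/5`, `c = 0`): `σ_0(k) + max(0·k + min(0, 2·0), 2·0·k − 4·max(0, 2·0)) ≤ E₀(h^G(θ_0 + (-46/5)·ε), k)`, `k ≤ 10`.
[cite: KullEtAl2024, §5.3] [cite: ValentiStolzeHirschfeld1991, §II] -/
theorem ybco7planeY6K26MarkovTable_m46o5_c0 : ∀ k ≤ 10,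
    ((kgp1x5_YBCO7x_c0_ll_mum92o10_sigma k : ℚ) : ℝ) + max ((0 : ℝ) * 2 / 2 * k + min 0 ((0 : ℝ) * 2)) ((0 : ℝ) * 2 * k - 4 * max 0 ((0 : ℝ) * 2)) ≤
      groundEnergy (hubbardOpenBoxGP 1 5 (plusTau (emeryLine cuprateSigns (ybco7planeY6K26Corner 0) + ((-46/5 : ℚ) : ℝ) • levelDir) 2)
        (plusUps (emeryLine cuprateSigns (ybco7planeY6K26Corner 0) + ((-46/5 : ℚ) : ℝ) • levelDir) 2)
        (plusNu (emeryLine cuprateSigns (ybco7planeY6K26Corner 0) + ((-46/5 : ℚ) : ℝ) • levelDir) 2)) k := by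
  have h := sectorFloors_plusGP_retilt (emeryLine cuprateSigns (ybco7planeY6K26Corner 0) + (-46/5 : ℝ) • levelDir) 2 (0 : ℝ) ybco7planeY6K26Floor_table0
  rw [tilt_add_retilt, show (-46/5 : ℝ) + 0 = ((-46/5 : ℚ) : ℝ) by norm_num] at h
  exact h

/-- **Corner 1, level -46/5** (from tilt `-49/5`, `c = 3/5`): `σ_1(k) + max(3/5·k + min(0, 2·3/5), 2·3/5·k − 4·max(0, 2·3/5)) ≤ E₀(h^G(θ_1 + (-46/5)·ε), k)`, `k ≤ 10`.
[cite: KullEtAl2024, §5.3] [cite: ValentiStolzeHirschfeld1991, §II] -/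
theorem ybco7planeY6K26MarkovTable_m46o5_c1 : ∀ k ≤ 10,
    ((kgp1x5_YBCO7x_c1_hl_mum98o10_sigma k : ℚ) : ℝ) + max ((3/5 : ℝ) * 2 / 2 * k + min 0 ((3/5 : ℝ) * 2)) ((3/5 : ℝ) * 2 * k - 4 * max 0 ((3/5 : ℝ) * 2)) ≤
      groundEnergy (hubbardOpenBoxGP 1 5 (plusTau (emeryLine cuprateSigns (ybco7planeY6K26Corner 1) + ((-46/5 : ℚ) : ℝ) • levelDir) 2)
        (plusUps (emeryLine cuprateSigns (ybco7planeY6K26Corner 1) + ((-46/5 : ℚ) : ℝ) • levelDir) 2)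
        (plusNu (emeryLine cuprateSigns (ybco7planeY6K26Corner 1) + ((-46/5 : ℚ) : ℝ) • levelDir) 2)) k := by
  have h := sectorFloors_plusGP_retilt (emeryLine cuprateSigns (ybco7planeY6K26Corner 1) + (-49/5 : ℝ) • levelDir) 2 (3/5 : ℝ) ybco7planeY6K26Floor_table1
  rw [tilt_add_retilt, show (-49/5 : ℝ) + 3/5 = ((-46/5 : ℚ) : ℝ) by norm_num] at h
  exact h

/-- **Corner 2, level -46/5** (from tilt `-19/2`, `c = 3/10`): `σ_2(k) + max(3/10·k + min(0, 2·3/10), 2·3/10·k − 4·max(0, 2·3/10)) ≤ E₀(h^G(θ_2 + (-46/5)·ε), k)`, `k ≤ 10`.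
[cite: KullEtAl2024, §5.3] [cite: ValentiStolzeHirschfeld1991, §II] -/
theorem ybco7planeY6K26MarkovTable_m46o5_c2 : ∀ k ≤ 10,
    ((kgp1x5_YBCO7x_c2_lh_mum95o10_sigma k : ℚ) : ℝ) + max ((3/10 : ℝ) * 2 / 2 * k + min 0 ((3/10 : ℝ) * 2)) ((3/10 : ℝ) * 2 * k - 4 * max 0 ((3/10 : ℝ) * 2)) ≤
      groundEnergy (hubbardOpenBoxGP 1 5 (plusTau (emeryLine cuprateSigns (ybco7planeY6K26Corner 2) + ((-46/5 : ℚ) : ℝ) • levelDir) 2)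
        (plusUps (emeryLine cuprateSigns (ybco7planeY6K26Corner 2) + ((-46/5 : ℚ) : ℝ) • levelDir) 2)
        (plusNu (emeryLine cuprateSigns (ybco7planeY6K26Corner 2) + ((-46/5 : ℚ) : ℝ) • levelDir) 2)) k := by
  have h := sectorFloors_plusGP_retilt (emeryLine cuprateSigns (ybco7planeY6K26Corner 2) + (-19/2 : ℝ) • levelDir) 2 (3/10 : ℝ) ybco7planeY6K26Floor_table2
  rw [tilt_add_retilt, show (-19/2 : ℝ) + 3/10 = ((-46/5 : ℚ) : ℝ) by norm_num] at h
  exact h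

/-- **Corner 3, level -46/5** (from tilt `-101/10`, `c = 9/10`): `σ_3(k) + max(9/10·k + min(0, 2·9/10), 2·9/10·k − 4·max(0, 2·9/10)) ≤ E₀(h^G(θ_3 + (-46/5)·ε), k)`, `k ≤ 10`.
[cite: KullEtAl2024, §5.3] [cite: ValentiStolzeHirschfeld1991, §II] -/
theorem ybco7planeY6K26MarkovTable_m46o5_c3 : ∀ k ≤ 10,
    ((kgp1x5_YBCO7x_c3_hh_mum101o10_sigma k : ℚ) : ℝ) + max ((9/10 : ℝ) * 2 / 2 * k + min 0 ((9/10 : ℝ) * 2)) ((9/10 : ℝ) * 2 * k - 4 * max 0 ((9/10 : ℝ) * 2)) ≤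
      groundEnergy (hubbardOpenBoxGP 1 5 (plusTau (emeryLine cuprateSigns (ybco7planeY6K26Corner 3) + ((-46/5 : ℚ) : ℝ) • levelDir) 2)
        (plusUps (emeryLine cuprateSigns (ybco7planeY6K26Corner 3) + ((-46/5 : ℚ) : ℝ) • levelDir) 2)
        (plusNu (emeryLine cuprateSigns (ybco7planeY6K26Corner 3) + ((-46/5 : ℚ) : ℝ) • levelDir) 2)) k := by
  have h := sectorFloors_plusGP_retilt (emeryLine cuprateSigns (ybco7planeY6K26Corner 3) + (-101/10 : ℝ) • levelDir) 2 (9/10 : ℝ) ybco7planeY6K26Floor_table3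
  rw [tilt_add_retilt, show (-101/10 : ℝ) + 9/10 = ((-46/5 : ℚ) : ℝ) by norm_num] at h
  exact h

/-! ## §2 The four entropy-resolved corner caps at level εp = -46/5 -/

/-- **CORNER 0, entropy-resolved cap** at level -46/5 (every β ≥ 0): `P_cell ≤ log max_{n≤4} Σ_{j≤6} C(6,j)·e^{−(β/2)·q_0(j+n)}`, `q_0(k) = σ_0(k) + max(0·k + min(0,2·0), 2·0·k − 4·max(0,2·0))`.
[cite: PoulinHastings2011, eqs. (3)–(8)] [cite: Israel1979, Thm. I.2.4] -/
theorem emeryBoxYBCO7planeY6K26_corner0_pressureCap_m46o5_markov {β : ℝ} (hβ : 0 ≤ β) :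
    emeryCellPressure β (emeryLine cuprateSigns (ybco7planeY6K26Corner 0) + ((-46/5 : ℚ) : ℝ) • levelDir) ≤
      Real.log ((Finset.range 5).sup' ⟨0, by simp⟩ fun n => ∑ j ∈ Finset.range 7, ((Nat.choose 6 j : ℕ) : ℝ) *
        Real.exp (-(β / 2 * (((kgp1x5_YBCO7x_c0_ll_mum92o10_sigma (j + n) : ℚ) : ℝ) +
          max ((0 : ℝ) * 2 / 2 * (j + n : ℕ) + min 0 ((0 : ℝ) * 2)) ((0 : ℝ) * 2 * (j + n : ℕ) - 4 * max 0 ((0 : ℝ) * 2)))))) := by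
  refine emeryCellPressure_le_log_of_gpSectorFloors _ (M := 2) two_pos hβ _ ybco7planeY6K26MarkovTable_m46o5_c0 ?_ fun n hn => ?_
  · exact lt_of_lt_of_le (sum_choose_exp_pos' _) (Finset.le_sup' (fun n => ∑ j ∈ Finset.range 7, ((Nat.choose 6 j : ℕ) : ℝ) *
        Real.exp (-(β / 2 * (((kgp1x5_YBCO7x_c0_ll_mum92o10_sigma (j + n) : ℚ) : ℝ) +
          max ((0 : ℝ) * 2 / 2 * (j + n : ℕ) + min 0 ((0 : ℝ) * 2)) ((0 : ℝ) * 2 * (j + n : ℕ) - 4 * max 0 ((0 : ℝ) * 2)))))) (Finset.mem_range.2 (by norm_num : 0 < 5)))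
  · exact Finset.le_sup' (fun n => ∑ j ∈ Finset.range 7, ((Nat.choose 6 j : ℕ) : ℝ) *
        Real.exp (-(β / 2 * (((kgp1x5_YBCO7x_c0_ll_mum92o10_sigma (j + n) : ℚ) : ℝ) +
          max ((0 : ℝ) * 2 / 2 * (j + n : ℕ) + min 0 ((0 : ℝ) * 2)) ((0 : ℝ) * 2 * (j + n : ℕ) - 4 * max 0 ((0 : ℝ) * 2)))))) (Finset.mem_range.2 (by omega))

/-- **CORNER 1, entropy-resolved cap** at level -46/5 (every β ≥ 0): `P_cell ≤ log max_{n≤4} Σ_{j≤6} C(6,j)·e^{−(β/2)·q_1(j+n)}`, `q_1(k) = σ_1(k) + max(3/5·k + min(0,2·3/5), 2·3/5·k − 4·max(0,2·3/5))`.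
[cite: PoulinHastings2011, eqs. (3)–(8)] [cite: Israel1979, Thm. I.2.4] -/
theorem emeryBoxYBCO7planeY6K26_corner1_pressureCap_m46o5_markov {β : ℝ} (hβ : 0 ≤ β) :
    emeryCellPressure β (emeryLine cuprateSigns (ybco7planeY6K26Corner 1) + ((-46/5 : ℚ) : ℝ) • levelDir) ≤
      Real.log ((Finset.range 5).sup' ⟨0, by simp⟩ fun n => ∑ j ∈ Finset.range 7, ((Nat.choose 6 j : ℕ) : ℝ) *
        Real.exp (-(β / 2 * (((kgp1x5_YBCO7x_c1_hl_mum98o10_sigma (j + n) : ℚ) : ℝ) +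
          max ((3/5 : ℝ) * 2 / 2 * (j + n : ℕ) + min 0 ((3/5 : ℝ) * 2)) ((3/5 : ℝ) * 2 * (j + n : ℕ) - 4 * max 0 ((3/5 : ℝ) * 2)))))) := by
  refine emeryCellPressure_le_log_of_gpSectorFloors _ (M := 2) two_pos hβ _ ybco7planeY6K26MarkovTable_m46o5_c1 ?_ fun n hn => ?_
  · exact lt_of_lt_of_le (sum_choose_exp_pos' _) (Finset.le_sup' (fun n => ∑ j ∈ Finset.range 7, ((Nat.choose 6 j : ℕ) : ℝ) *
        Real.exp (-(β / 2 * (((kgp1x5_YBCO7x_c1_hl_mum98o10_sigma (j + n) : ℚ) : ℝ) +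
          max ((3/5 : ℝ) * 2 / 2 * (j + n : ℕ) + min 0 ((3/5 : ℝ) * 2)) ((3/5 : ℝ) * 2 * (j + n : ℕ) - 4 * max 0 ((3/5 : ℝ) * 2)))))) (Finset.mem_range.2 (by norm_num : 0 < 5)))
  · exact Finset.le_sup' (fun n => ∑ j ∈ Finset.range 7, ((Nat.choose 6 j : ℕ) : ℝ) *
        Real.exp (-(β / 2 * (((kgp1x5_YBCO7x_c1_hl_mum98o10_sigma (j + n) : ℚ) : ℝ) +
          max ((3/5 : ℝ) * 2 / 2 * (j + n : ℕ) + min 0 ((3/5 : ℝ) * 2)) ((3/5 : ℝ) * 2 * (j + n : ℕ) - 4 * max 0 ((3/5 : ℝ) * 2)))))) (Finset.mem_range.2 (by omega))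

/-- **CORNER 2, entropy-resolved cap** at level -46/5 (every β ≥ 0): `P_cell ≤ log max_{n≤4} Σ_{j≤6} C(6,j)·e^{−(β/2)·q_2(j+n)}`, `q_2(k) = σ_2(k) + max(3/10·k + min(0,2·3/10), 2·3/10·k − 4·max(0,2·3/10))`.
[cite: PoulinHastings2011, eqs. (3)–(8)] [cite: Israel1979, Thm. I.2.4] -/
theorem emeryBoxYBCO7planeY6K26_corner2_pressureCap_m46o5_markov {β : ℝ} (hβ : 0 ≤ β) :
    emeryCellPressure β (emeryLine cuprateSigns (ybco7planeY6K26Corner 2) + ((-46/5 : ℚ) : ℝ) • levelDir) ≤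
      Real.log ((Finset.range 5).sup' ⟨0, by simp⟩ fun n => ∑ j ∈ Finset.range 7, ((Nat.choose 6 j : ℕ) : ℝ) *
        Real.exp (-(β / 2 * (((kgp1x5_YBCO7x_c2_lh_mum95o10_sigma (j + n) : ℚ) : ℝ) +
          max ((3/10 : ℝ) * 2 / 2 * (j + n : ℕ) + min 0 ((3/10 : ℝ) * 2)) ((3/10 : ℝ) * 2 * (j + n : ℕ) - 4 * max 0 ((3/10 : ℝ) * 2)))))) := by
  refine emeryCellPressure_le_log_of_gpSectorFloors _ (M := 2) two_pos hβ _ ybco7planeY6K26MarkovTable_m46o5_c2 ?_ fun n hn => ?_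
  · exact lt_of_lt_of_le (sum_choose_exp_pos' _) (Finset.le_sup' (fun n => ∑ j ∈ Finset.range 7, ((Nat.choose 6 j : ℕ) : ℝ) *
        Real.exp (-(β / 2 * (((kgp1x5_YBCO7x_c2_lh_mum95o10_sigma (j + n) : ℚ) : ℝ) +
          max ((3/10 : ℝ) * 2 / 2 * (j + n : ℕ) + min 0 ((3/10 : ℝ) * 2)) ((3/10 : ℝ) * 2 * (j + n : ℕ) - 4 * max 0 ((3/10 : ℝ) * 2)))))) (Finset.mem_range.2 (by norm_num : 0 < 5)))
  · exact Finset.le_sup' (fun n => ∑ j ∈ Finset.range 7, ((Nat.choose 6 j : ℕ) : ℝ) *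
        Real.exp (-(β / 2 * (((kgp1x5_YBCO7x_c2_lh_mum95o10_sigma (j + n) : ℚ) : ℝ) +
          max ((3/10 : ℝ) * 2 / 2 * (j + n : ℕ) + min 0 ((3/10 : ℝ) * 2)) ((3/10 : ℝ) * 2 * (j + n : ℕ) - 4 * max 0 ((3/10 : ℝ) * 2)))))) (Finset.mem_range.2 (by omega))

/-- **CORNER 3, entropy-resolved cap** at level -46/5 (every β ≥ 0): `P_cell ≤ log max_{n≤4} Σ_{j≤6} C(6,j)·e^{−(β/2)·q_3(j+n)}`, `q_3(k) = σ_3(k) + max(9/10·k + min(0,2·9/10), 2·9/10·k − 4·max(0,2·9/10))`.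
[cite: PoulinHastings2011, eqs. (3)–(8)] [cite: Israel1979, Thm. I.2.4] -/
theorem emeryBoxYBCO7planeY6K26_corner3_pressureCap_m46o5_markov {β : ℝ} (hβ : 0 ≤ β) :
    emeryCellPressure β (emeryLine cuprateSigns (ybco7planeY6K26Corner 3) + ((-46/5 : ℚ) : ℝ) • levelDir) ≤
      Real.log ((Finset.range 5).sup' ⟨0, by simp⟩ fun n => ∑ j ∈ Finset.range 7, ((Nat.choose 6 j : ℕ) : ℝ) *
        Real.exp (-(β / 2 * (((kgp1x5_YBCO7x_c3_hh_mum101o10_sigma (j + n) : ℚ) : ℝ) +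
          max ((9/10 : ℝ) * 2 / 2 * (j + n : ℕ) + min 0 ((9/10 : ℝ) * 2)) ((9/10 : ℝ) * 2 * (j + n : ℕ) - 4 * max 0 ((9/10 : ℝ) * 2)))))) := by
  refine emeryCellPressure_le_log_of_gpSectorFloors _ (M := 2) two_pos hβ _ ybco7planeY6K26MarkovTable_m46o5_c3 ?_ fun n hn => ?_
  · exact lt_of_lt_of_le (sum_choose_exp_pos' _) (Finset.le_sup' (fun n => ∑ j ∈ Finset.range 7, ((Nat.choose 6 j : ℕ) : ℝ) *
        Real.exp (-(β / 2 * (((kgp1x5_YBCO7x_c3_hh_mum101o10_sigma (j + n) : ℚ) : ℝ) +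
          max ((9/10 : ℝ) * 2 / 2 * (j + n : ℕ) + min 0 ((9/10 : ℝ) * 2)) ((9/10 : ℝ) * 2 * (j + n : ℕ) - 4 * max 0 ((9/10 : ℝ) * 2)))))) (Finset.mem_range.2 (by norm_num : 0 < 5)))
  · exact Finset.le_sup' (fun n => ∑ j ∈ Finset.range 7, ((Nat.choose 6 j : ℕ) : ℝ) *
        Real.exp (-(β / 2 * (((kgp1x5_YBCO7x_c3_hh_mum101o10_sigma (j + n) : ℚ) : ℝ) +
          max ((9/10 : ℝ) * 2 / 2 * (j + n : ℕ) + min 0 ((9/10 : ℝ) * 2)) ((9/10 : ℝ) * 2 * (j + n : ℕ) - 4 * max 0 ((9/10 : ℝ) * 2)))))) (Finset.mem_range.2 (by omega))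

/-! ## §3 The box word -/

/-- **THE ENTROPY-RESOLVED `T > 0` CAP WORD on `emeryBoxYBCO7planeY6K26`** (hypothesis-free, every β ≥ 0, every point, level εp = -46/5 ⇔ chemical potential `46/5` eV):
`P_cell(β) ≤ maxᵢ log Fᵢ(β)` with the four corner functions of §2 [float: `40.3430·β + 2.7081` for large β versus the flat re-tilted word
`40.3430·β + 4.1589` of `emeryBoxYBCO7planeY6K26_pressureCap_m46o5_retilt`]. [cite: Israel1979, Thm. I.3.4] [cite: PoulinHastings2011, eqs. (3)–(8)] -/
theorem emeryBoxYBCO7planeY6K26_pressureCap_m46o5_markov {β : ℝ} (hβ : 0 ≤ β) :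
    HoldsOn (fun p : EmeryCoord → ℝ =>
      emeryCellPressure β (emeryLine cuprateSigns (emeryLineCoords (((-46/5 : ℚ)) : ℝ) p)) ≤
        max (max
          (Real.log ((Finset.range 5).sup' ⟨0, by simp⟩ fun n => ∑ j ∈ Finset.range 7, ((Nat.choose 6 j : ℕ) : ℝ) *
        Real.exp (-(β / 2 * (((kgp1x5_YBCO7x_c0_ll_mum92o10_sigma (j + n) : ℚ) : ℝ) +
          max ((0 : ℝ) * 2 / 2 * (j + n : ℕ) + min 0 ((0 : ℝ) * 2)) ((0 : ℝ) * 2 * (j + n : ℕ) - 4 * max 0 ((0 : ℝ) * 2)))))))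
          (Real.log ((Finset.range 5).sup' ⟨0, by simp⟩ fun n => ∑ j ∈ Finset.range 7, ((Nat.choose 6 j : ℕ) : ℝ) *
        Real.exp (-(β / 2 * (((kgp1x5_YBCO7x_c1_hl_mum98o10_sigma (j + n) : ℚ) : ℝ) +
          max ((3/5 : ℝ) * 2 / 2 * (j + n : ℕ) + min 0 ((3/5 : ℝ) * 2)) ((3/5 : ℝ) * 2 * (j + n : ℕ) - 4 * max 0 ((3/5 : ℝ) * 2))))))))
          (max
          (Real.log ((Finset.range 5).sup' ⟨0, by simp⟩ fun n => ∑ j ∈ Finset.range 7, ((Nat.choose 6 j : ℕ) : ℝ) *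
        Real.exp (-(β / 2 * (((kgp1x5_YBCO7x_c2_lh_mum95o10_sigma (j + n) : ℚ) : ℝ) +
          max ((3/10 : ℝ) * 2 / 2 * (j + n : ℕ) + min 0 ((3/10 : ℝ) * 2)) ((3/10 : ℝ) * 2 * (j + n : ℕ) - 4 * max 0 ((3/10 : ℝ) * 2)))))))
          (Real.log ((Finset.range 5).sup' ⟨0, by simp⟩ fun n => ∑ j ∈ Finset.range 7, ((Nat.choose 6 j : ℕ) : ℝ) *
        Real.exp (-(β / 2 * (((kgp1x5_YBCO7x_c3_hh_mum101o10_sigma (j + n) : ℚ) : ℝ) +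
          max ((9/10 : ℝ) * 2 / 2 * (j + n : ℕ) + min 0 ((9/10 : ℝ) * 2)) ((9/10 : ℝ) * 2 * (j + n : ℕ) - 4 * max 0 ((9/10 : ℝ) * 2)))))))))
      emeryBoxYBCO7planeY6K26 := by
  refine holdsOn_emeryCellPressureCap_of_cornerCaps (E := emeryBoxYBCO7planeY6K26) (eA := ybco7planeY6K26Emery_tpd) (eB := ybco7planeY6K26Emery_tpp) (eD := ybco7planeY6K26Emery_Delta) (eUd := ybco7planeY6K26Emery_Udd) (eUp := ybco7planeY6K26Emery_Upp) (by simp [emeryBoxYBCO7planeY6K26, emeryBoxYBCO7planeY6K26Src, Function.update]) (by simp [emeryBoxYBCO7planeY6K26, emeryBoxYBCO7planeY6K26Src, Function.update]) (Function.update_self _ _ _) (by simp [emeryBoxYBCO7planeY6K26, emeryBoxYBCO7planeY6K26Src, Function.update]) (by simp [emeryBoxYBCO7planeY6K26, emeryBoxYBCO7planeY6K26Src, Function.update]) cuprateSigns hβ fun i => ?_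
  rw [emeryLine_lowerCorner_level, ybco7planeY6K26_lowerCorner]
  fin_cases i
  · exact le_max_of_le_left (le_max_of_le_left (emeryBoxYBCO7planeY6K26_corner0_pressureCap_m46o5_markov hβ))
  · exact le_max_of_le_left (le_max_of_le_right (emeryBoxYBCO7planeY6K26_corner1_pressureCap_m46o5_markov hβ))
  · exact le_max_of_le_right (le_max_of_le_left (emeryBoxYBCO7planeY6K26_corner2_pressureCap_m46o5_markov hβ))
  · exact le_max_of_le_right (le_max_of_le_right (emeryBoxYBCO7planeY6K26_corner3_pressureCap_m46o5_markov hβ))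

end Summit.Ventures.CertifiedManyBodySolver.Downfold

end
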